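import Summits.BirchSwinnertonDyer.BirchSwinnertonDyer.Theorems.EdixhovenFibreFiveSevenStarredOptimalManinUnitFiveSevenTransportedReciprocityTransportAllPointsOfFormalPoints
import Summits.BirchSwinnertonDyer.BirchSwinnertonDyer.Theorems.EdixhovenFibreFiveSevenStarredOptimalManinUnitFiveSevenTransportedReciprocityOfVariableChange
import HarnessLib

/-!
# Kato's explicit reciprocity law for a curve related to a good `𝒪_D`-model by ONE change of variables over `K_v`, FROM the formula at the points over deep FORMAL points —
# the GENERIC E6 (`…TransportedReciprocityOfVariableChange`) abstracted over its formal-point input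

Cell `pub/bsd-wall`, D-0145 line `route-BirchSwinnertonDyer-EdixhovenFibreFiveSeven`, seat `bsd-line-edix-p4` (gen 29, width); crux K★
`stmt-BirchSwinnertonDyer-22226` (`StarredOptimalManinUnitFiveSeven`), line `kato_lever`, stub `stub_localFormulaOrdinaryCells`. THEOREMS ONLY (no definition, no
named fact, no instance, no `sorry`); helper `--supports stmt-BirchSwinnertonDyer-22226`. **BSD is not proved by this file, and neither is K★ or the LOC@ord stub.**
Sequel of `…TransportedReciprocityTransportAllPointsOfFormalPoints` (E4/E5 over an E3-shaped hypothesis): here E6 — ONE change of variables `C` over `F = K_v` with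
`C • (W ⊗ F) = E := curveFO F (W_D ⊗_ψ 𝒪_F)`, `|u_C|_w ≤ 1` — over the HYPOTHESIS `hformalT` that the formal-point formula (E3's output shape, division sequences formal at
every level) holds for EVERY equivariant isomorphism `φ : (W ⊗ F)(F̄) ≃ E(F̄)` with a Tate-module map (this is how the capstones are stated). The model is only assumed
to have `Δ ∈ 𝒪_Fˣ` and `[Xᵖ][p]` a unit in `𝒪_{ℂ_F}`. Proof: E6's — transport data of `C` (`exists_transportData_of_variableChange`), the log rescaling
`padicLogPointFiniteExt_congrEquiv_pointMap_of_isNonarchimedeanLocalField`, and `…_transport_of_formalPoints_of_log_eq`.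

* ★★★ `exists_const_tatePairingPoint_eq_trace_mul_padicLog_of_variableChange_of_formalPoints` — **`hformalT` ⟹ `∃ c, ∀ η, ∀ P ∈ W(F): ⟨[η], P⟩_W =
  Tr_{F/ℚ_p}(c · exp*_d(η) · log_ω^{W ⊗ F}(P))`** (E6's shape = the input of the cell numerology `…LocalFormulaSupersingularCellsNumerology` §7).

So the ORDINARY chain closes as: ordinary capstone in transport form (LEAD, E3's shape with `hker ∀ n`) ⟹ this theorem ⟹ the cell numerology with
`…OrdinaryCellsModels.exists_goodModelData_of_ordinary_numerology` / `valuation_u_le_one_of_smul_eq_curveFO` (p794676/p795849).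

References: [cite: Kato1993LNM1553, Ch. II Thm. 1.4.1 (3)–(4), Lemma 1.4.3] · [cite: SilvermanAEC2009, III.1 Table 3.1, Prop. III.3.1(b), Thm. IV.6.4, X §4].
-/

set_option autoImplicit false
-- single-conjunct summit: `Summit.BirchSwinnertonDyer.BirchSwinnertonDyer.…` repeats the name by design
set_option linter.dupNamespace false

noncomputable section

open Field Function ValuativeRel WittVector NumberField IsDedekindDomain
open scoped NumberField Topology Classical NNReal
open Literature.NumberTheory.PAdicHodge Literature.NumberTheory.GaloisRepresentations
  Literature.NumberTheory.GaloisRepresentations.IsNonarchimedeanLocalField Literature.NumberTheory.GaloisRepresentations.LubinTate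
  Literature.NumberTheory.GaloisCohomology Literature.NumberTheory.EllipticCurves Literature.NumberTheory.EllipticCurves.FormalGroupChart
  Literature.NumberTheory.PAdicHodge.GaloisContinuity Literature.IUT.LogVolume Literature.RingTheory.FormalGroups
  Literature.AlgebraicGeometry.Resolution _root_.WeierstrassCurve

namespace Summit.BirchSwinnertonDyer.BirchSwinnertonDyer.Theorems.TransportedReciprocityOfVariableChangeOfFormalPoints

variable {K : Type} [Field K] [NumberField K] {p : ℕ} [hprime : Fact p.Prime] (v : HeightOneSpectrum (𝓞 K))
  [CharZero (v.adicCompletion K)] [Fact (¬ IsUnit (p : integerC (v.adicCompletion K)))]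
  [IsAdicComplete (Ideal.span {(p : integerC (v.adicCompletion K))}) (integerC (v.adicCompletion K))]
  [CharZero (CompletedAlgClosure (v.adicCompletion K))]
  (hpv : valuation (v.adicCompletion K) (p : v.adicCompletion K) < 1)
  (Dv : EisensteinRoot (v.adicCompletion K) p hpv) (Wm : WeierstrassCurve (EisensteinRoot.CoeffDisc Dv))
  (ψm : EisensteinRoot.CoeffDisc Dv →+* LTCoeff (v.adicCompletion K))
  (hψm : ∀ c, algebraMap (LTCoeff (v.adicCompletion K)) (v.adicCompletion K) (ψm c) = EisensteinRoot.CoeffDisc.toF Dv c)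
  (hΔ : IsUnit (Wm.map ψm).Δ)
  (h1 : IsUnit (algebraMap (LTCoeff (v.adicCompletion K)) (CBall (v.adicCompletion K)) (PowerSeries.coeff p ((Wm.map ψm).formalMul p))))
  [(AinfTop.curveFO (v.adicCompletion K) (Wm.map ψm)).IsElliptic]
  [(curveOver (CompletedAlgClosure (v.adicCompletion K)) (Wm.map ψm)).IsElliptic]
  -- the curve `W/K₀` and its Weil tower
  {K₀ : Type} [Field K₀] [CharZero K₀] (W : WeierstrassCurve K₀) [W.IsElliptic] [Algebra K₀ (v.adicCompletion K)]
  (e : (k : ℕ) → geomTorsion W ((p ^ k : ℕ) : ℤ) → geomTorsion W ((p ^ k : ℕ) : ℤ) → AlgebraicClosure K₀)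
  (hμ : ∀ k S T, e k S T ^ (p ^ k) = 1) (hadd₁ : ∀ k S₁ S₂ T, e k (S₁ + S₂) T = e k S₁ T * e k S₂ T)
  (hadd₂ : ∀ k S T₁ T₂, e k S (T₁ + T₂) = e k S T₁ * e k S T₂)
  (hgal : ∀ k (σ : absoluteGaloisGroup K₀) (S T : geomTorsion W ((p ^ k : ℕ) : ℤ)), σ • e k S T = e k (σ • S) (σ • T))
  (hcompat : ∀ k (S T : geomTorsion W ((p ^ (k + 1) : ℕ) : ℤ)),
    e k (torsionMulHom W (p ^ (k + 1)) (p ^ k) p (pow_succ p k).symm S)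
      (torsionMulHom W (p ^ (k + 1)) (p ^ k) p (pow_succ p k).symm T) = e (k + 1) S T ^ p)

set_option maxHeartbeats 1600000 in
include hΔ h1 hψm in
/-- ★★★ **Kato's formula in the shape `hrec′` from ONE change of variables onto the good model, GIVEN the formula at the points over deep formal points for every
transport isomorphism.** `F = K_v`; `E = curveFO F (W_D ⊗_ψ 𝒪_F)` with `Δ ∈ 𝒪_Fˣ` and `[Xᵖ][p]` a unit in `𝒪_{ℂ_F}`; `W/K₀` (`K₀ ⊆ F`) elliptic with its Weil tower and a
line datum `d` of `T_pW|_{Γ_F}`; an admissible change of variables `C` over `F` with `C • (W ⊗ F) = E` and `|u_C|_w ≤ 1` for a compatible `w` making `W ⊗ F` and `E`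
integral. HYPOTHESIS `hformalT`: for EVERY `Γ_F`-equivariant `φ : (W ⊗ F)(F̄) ≃ E(F̄)` with Tate-module map `T_p(φ)`, the formal-point formula in E3's shape (division
sequences with `φ(Q n)` formal for all `n`, depth `‖z(φ Q₀)‖^N ≤ ‖p‖`, chart for `c_P`). CONCLUSION: ONE `c ∈ F` with **`⟨[η], P⟩_W = Tr_{F/ℚ_p}(c · exp*_d(η) · log_ω(P))`**
for every cocycle `η` and EVERY `P ∈ W(F)`, `log_ω = padicLogPointFiniteExt w (W ⊗ F) p`.
[cite: Kato1993LNM1553, Ch. II Thm. 1.4.1 (3)–(4), Lemma 1.4.3] [cite: SilvermanAEC2009, III.1 Table 3.1, Prop. III.3.1(b), X §4] -/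
theorem exists_const_tatePairingPoint_eq_trace_mul_padicLog_of_variableChange_of_formalPoints {N : ℕ} (hN0 : N ≠ 0)
    (d : letI := LocalField.padicAlgebra (v.adicCompletion K) p hpv
      (bdRPeriodRingData (F := (v.adicCompletion K)) (p := p) hpv).FilZeroLine
        (restrictedRationalTateRep W (v.adicCompletion K) p))
    (hformalT : letI := LocalField.padicAlgebra (v.adicCompletion K) p hpv
      ∀ (φ : geomPoints (W.baseChange (v.adicCompletion K)) ≃+ (AinfTop.curveFO (v.adicCompletion K) (Wm.map ψm)).geomPoints)
        (_hφ : ∀ (σ : absoluteGaloisGroup (v.adicCompletion K)) (P : geomPoints (W.baseChange (v.adicCompletion K))), φ (σ • P) = σ • φ P)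
        (Tφ : (W.baseChange (v.adicCompletion K)).tateModule p ≃ₗ[ℤ_[p]] (AinfTop.curveFO (v.adicCompletion K) (Wm.map ψm)).tateModule p)
        (_hTφ : ∀ (a : (W.baseChange (v.adicCompletion K)).tateModule p) (n : ℕ), TateModule.proj p n (Tφ a) = φ (TateModule.proj p n a)),
      ∃ c : v.adicCompletion K,
      ∀ (η : contOneCocycles (restrictedTateRep W (v.adicCompletion K) p).toTopRep)
        (P : (W.baseChange (v.adicCompletion K)).toAffine.Point)
        (Q : ℕ → geomPoints (W.baseChange (v.adicCompletion K)))
        (_hQ : ∀ n, p • Q (n + 1) = Q n)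
        (_hQ0 : Q 0 = toGeomPoints (W.baseChange (v.adicCompletion K)) P)
        (hker : ∀ n, AinfTop.geomToCO (Wm.map ψm) ((⇑φ ∘ Q) n) ∈ kernel (NormedField.valuation (K := CompletedAlgClosure (v.adicCompletion K)))
          (curveOver (CompletedAlgClosure (v.adicCompletion K)) (Wm.map ψm))),
        ‖((zPt (AinfTop.geomToCO (Wm.map ψm) ((⇑φ ∘ Q) 0)) (hker 0) : CBall (v.adicCompletion K)) : CompletedAlgClosure (v.adicCompletion K))‖ ^ N ≤
            ‖(p : CompletedAlgClosure (v.adicCompletion K))‖ →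
        ∀ cP : v.adicCompletion K,
          algebraMap (v.adicCompletion K) (CompletedAlgClosure (v.adicCompletion K)) cP =
            (p : CompletedAlgClosure (v.adicCompletion K)) ^ N *
              ∑' j : ℕ, PowerSeries.coeff j (Wm.map ((CBall (v.adicCompletion K)).subtype.comp (EisensteinRoot.CoeffDisc.toCBall Dv))).formalLog *
                ((zPt (AinfTop.geomToCO (Wm.map ψm) ((⇑φ ∘ Q) 0)) (hker 0) : CBall (v.adicCompletion K)) : CompletedAlgClosure (v.adicCompletion K)) ^ j →
          ((tatePairingPoint W (v.adicCompletion K) p e hμ hadd₁ hadd₂ hgal hcompat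
              (oneCocycleClass _ η) P : ℤ_[p]) : ℚ_[p]) =
            -Algebra.trace ℚ_[p] (v.adicCompletion K) (cP * (expStarCoord W hpv d η * c)))
    -- the change of variables onto the model and the valuation for `log_ω`
    (w : Valuation (v.adicCompletion K) ℝ≥0) [w.Compatible] [(AinfTop.curveFO (v.adicCompletion K) (Wm.map ψm)).IsIntegral w.integer]
    [(W.baseChange (v.adicCompletion K)).IsIntegral w.integer]
    (C : VariableChange (v.adicCompletion K)) (hC : C • W.baseChange (v.adicCompletion K) = AinfTop.curveFO (v.adicCompletion K) (Wm.map ψm))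
    (hu : w (C.u : v.adicCompletion K) ≤ 1) :
    letI := LocalField.padicAlgebra (v.adicCompletion K) p hpv
    ∃ c : v.adicCompletion K,
      ∀ (η : contOneCocycles (restrictedTateRep W (v.adicCompletion K) p).toTopRep) (P : (W.baseChange (v.adicCompletion K)).toAffine.Point),
        ((tatePairingPoint W (v.adicCompletion K) p e hμ hadd₁ hadd₂ hgal hcompat (oneCocycleClass _ η) P : ℤ_[p]) : ℚ_[p]) =
          Algebra.trace ℚ_[p] (v.adicCompletion K)
            (c * expStarCoord W hpv d η * padicLogPointFiniteExt w (W.baseChange (v.adicCompletion K)) p P) := by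
  letI := LocalField.padicAlgebra (v.adicCompletion K) p hpv
  haveI : (W.baseChange (v.adicCompletion K)).IsElliptic := inferInstance
  -- the transport data of `C`
  obtain ⟨φ, Tφ, φF, hφ, hTφ, hφF, hφFC⟩ := exists_transportData_of_variableChange (W.baseChange (v.adicCompletion K)) C p hC
  -- the rescaling of `log_ω`
  have hlogφ : ∀ P, padicLogPointFiniteExt w (AinfTop.curveFO (v.adicCompletion K) (Wm.map ψm)) p (φF P) =
      (C.u : v.adicCompletion K) * padicLogPointFiniteExt w (W.baseChange (v.adicCompletion K)) p P := fun P => by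
    rw [hφFC P]
    exact padicLogPointFiniteExt_congrEquiv_pointMap_of_isNonarchimedeanLocalField (W.baseChange (v.adicCompletion K)) C w hC hpv hu P
  exact TransportedReciprocityTransportAllPointsOfFormalPoints.exists_const_tatePairingPoint_eq_trace_mul_padicLog_transport_of_formalPoints_of_log_eq v hpv
    Dv Wm ψm hψm hΔ h1 W φ e hμ hadd₁ hadd₂ hgal hcompat w φF hφF hN0 d (hformalT φ hφ Tφ hTφ) w (C.u : v.adicCompletion K) hlogφ

end Summit.BirchSwinnertonDyer.BirchSwinnertonDyer.Theorems.TransportedReciprocityOfVariableChangeOfFormalPoints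

end
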